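import Summits.QuantumFields.YangMills.Theorems.BalabanUVNodesN19ExpectationCurrencyTwoConstantsAtScheme
import Mathlib.Analysis.SpecialFunctions.Log.PosLog
import Mathlib.Analysis.SpecialFunctions.Trigonometric.Deriv

/-!
# YM-DAG node N19 (= NE7 proper) — THE PRICE OF THE EXPECTATION CURRENCY IS EXACTLY `ε·log ε⁻¹ ∕ log log ε⁻¹`: the lineage's linear-log
# upper bound (p480837) comes DOWN by a `log log` to meet its grid-Chebyshev lower bound (p510514) — two-sided, typed

Cell `pub-ymgap`, HUMAN RULING D-0062 (Track A), R141 (C) wider-strategy seat `pub-ymgap-dag-n19-e` (strategy s3 = ALTERNATIVE CURRENCY), generation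
g13, module 1 of 2 (the sibling `…Theorems.BalabanUVNodesN19SharpPriceTwoSided`, filed right after, carries the lower-bound ∕ two-sided half — 400-line
rule).  Route `Summits/QuantumFields/YangMills/Theses/BalabanUVNodes.lean` rev 19, cluster item K3⁗ «SpineGivenEndpointR13Sep»
(stmt-QuantumFields-20292); filed `--supports` that item `--as helper` (it proves no registered stub).  COUNT-NEUTRAL: elementary complex analysis ∕
probability over Mathlib on top of the seat's own modules BY NAME — p480837 `…N19ExpectationCurrencyTwoConstants` (`norm_deriv_le_linlog`, the disc ∕
diameter two-constants derivative bound; `abs_mgf_sub_mgf_le_of_cgf_close`), p481156 `…TwoConstantsAtScheme` (scheme vocabulary, §4 only); NOT a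
discharge claim.

THE QUESTION IT CLOSES.  p480837: `|∫Y dν − ∫X dμ| ≤ 4e^{1+l₀B}·ε·(1 + log⁺ ε⁻¹)∕l₀` for `[−B, B]`-valued observables with cgf's `ε`-close on the window;
p509390 ∕ p510514 ∕ p511222: grid witnesses with `|ΔE|∕ε ≍ log ε⁻¹∕log log ε⁻¹`, and in `…N19NoLinearPriceSharp`'s header «WHAT STAYS OPEN (honest): the
`log log` between the two; a family without the `log log` would need non-grid extremal signed measures — not attempted (no Mathlib path)».  SETTLED
HERE THE OTHER WAY: no such family exists — the UPPER bound improves to the witnesses' order; the price function of the currency is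
`P(ε) = ε·(1 + log⁺ ε⁻¹)∕log(e + log⁺ ε⁻¹)` up to `l₀`-constants on BOTH sides (upper: this module; lower + two-sided: the sibling's
★★ `sharp_price_two_sided`, from p510514's `exists_cgf_close_means_far`).

THE MECHANISM (one new step, then p480837's own lemma).  p480837 bounded `f = complexMGF_ν − complexMGF_μ` by `2e^{l₀B}` on the disc `|z| ≤ l₀` whose
diameter is the window.  But `f` is ENTIRE OF EXPONENTIAL TYPE — `‖f z‖ ≤ 2e^{‖z‖B}` on ALL of `ℂ` (`T4GenFunBounds.norm_complexMGF_le_of_abs_le`) — while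
smallness is known on the SHORT real segment `[−l₀, l₀]` only.  The entire gauge `φ(w) = l₀·sin(Kw)` maps the real line into that segment, the disc
`|w| ≤ r` into `|z| ≤ l₀e^{Kr}` (`‖sin w‖ ≤ e^{|Im w|}`), with `φ′(0) = l₀K`; the disc ∕ diameter lemma for `f ∘ φ` gives §1
`‖f′(0)‖ ≤ 2e·m·(1 + log⁺(M∕m))∕(r·l₀·K)`, `M` the bound on the BIG disc (the harmonic measure of a short slit seen from a large circle, in elementary
coin).  §2 (`r = 1`): for every `K > 0`, `|ΔE| ≤ 4e^{1+l₀B}·ε·(1 + l₀B(e^{K} − 1) + log⁺ ε⁻¹)∕(l₀K)`; at `e^{K} = e + log⁺ ε⁻¹`: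
★★ `|ΔE| ≤ 4e^{1+e·l₀B}·ε·(1 + log⁺ ε⁻¹)∕(l₀·log(e + log⁺ ε⁻¹))`.  §4: N19's DECL target in this currency — `MatchingModConstants vol l₀ δ (schemeZ S os)`
pays `|⟨∏os⟩_{K+1} − ⟨∏os⟩_K| ≤ (8e^{1+e·l₀}∕l₀)·volδ_K·(1 + log⁺(2volδ_K)⁻¹)∕log(e + log⁺(2volδ_K)⁻¹)` (p481156's increment bound divided by the `log log`;
its rate ∕ limit corollaries improve the same way — not re-typed, no consumer).

KERNEL-CHECKED (0 `def`, 0 `sorry`): §1 [folklore] `norm_deriv_le_linlog_of_short_segment` · §2 [folklore] `abs_integral_sub_integral_le_of_cgf_close_gauge`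
(every `K > 0`), ★★ `abs_integral_sub_integral_le_sharp_of_cgf_close` · §4 [bookkeeping] `abs_expectAt_succ_sub_le_sharp_of_matchingModConstants`
(§3 = the sibling).  The CLOSED window `|t| ≤ l₀` is used throughout (`MatchingModConstants`' own; the gauge reaches `±l₀`).  NOT claimed: optimal
constants (`C(l₀)∕c(l₀)` is not tracked); all-order cumulant versions (the same gauge gives them; no consumer).

HONEST FRAMING (binding).  Elementary; NO consumer in the DAG today (the apex consumes existence of limits, not rates); value = the optimality certificate
of the lineage's currency, now two-sided, and a `log log`-sharper constant road for p481156 ∕ p482030 ∕ the planner's K3 rate stubs (a rate carried as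
«cgf-matching mod constants `δ_K` on a window» converts to expectations at the price `δ_K·log δ_K⁻¹∕log log δ_K⁻¹`, exactly).  Nothing of
[Balaban1987RG1]–[Balaban1989LargeFieldII] or [King1986] is asserted, quoted or instantiated; NE7 ∕ NE7b ∕ NE7c NOT PRINTED, NOT proved; N19 NOT discharged;
Track A count unmoved (typed 28∕28 · discharged 5∕27 · A 5∕28).  One finite `T⁴` programme at fixed `ε`; nothing continuum ∕ `ℝ⁴` ∕ OS ∕ mass-gap ∕ Clay.
THEOREMS ONLY; standard axioms; no decl carries a cite tag (the two-constants theorem is the tree's, used by name through p480837).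
-/

set_option autoImplicit false

noncomputable section

open Set Metric Filter Topology MeasureTheory ProbabilityTheory Complex
open scoped BigOperators

namespace Summit.QuantumFields.YangMills.Theorems.BalabanUVNodesN19SharpPrice

open Literature.MathematicalPhysics.QuantumFieldTheory.Balaban1983to89
open Summit.QuantumFields.YangMills.BalabanUVNodes.N19ExpectationCurrencyTwoConstants
  (norm_deriv_le_linlog norm_complexMGF_sub_complexMGF_le abs_mgf_sub_mgf_le_of_cgf_close)

/-! ## §1 Complex analysis: two constants with smallness on a SHORT real segment inside a big disc [folklore] -/

section Complex

variable {E : Type*} [NormedAddCommGroup E] [NormedSpace ℂ E]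

/-- **Derivative at the centre from two constants, SHORT-SEGMENT form.**  `f` entire, `‖f z‖ ≤ M` on the big disc `‖z‖ ≤ l₀·e^{Kr}`,
`‖f x‖ ≤ m` for real `|x| ≤ l₀` only (`0 ≤ m`; `0 < l₀, K, r`); then `‖f′(0)‖ ≤ 2e·m·(1 + log⁺(M∕m))∕(r·l₀·K)` — the disc ∕ diameter form
(`N19ExpectationCurrencyTwoConstants.norm_deriv_le_linlog`) applied on `‖w‖ ≤ r` to `f ∘ φ` with the entire gauge `φ(w) = l₀·sin(Kw)`: `φ(ℝ) ⊆ [−l₀, l₀]`,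
`‖φ(w)‖ ≤ l₀·e^{K|Im w|}` (`‖sin w‖ ≤ e^{|Im w|}`), `φ(0) = 0`, `φ′(0) = l₀K`. [folklore] -/
theorem norm_deriv_le_linlog_of_short_segment {f : ℂ → E} {m M l₀ K r : ℝ} (hl₀ : 0 < l₀) (hK : 0 < K) (hr : 0 < r)
    (hf : Differentiable ℂ f) (hM : ∀ z : ℂ, ‖z‖ ≤ l₀ * Real.exp (K * r) → ‖f z‖ ≤ M)
    (hm : ∀ x : ℝ, |x| ≤ l₀ → ‖f x‖ ≤ m) (hm0 : 0 ≤ m) :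
    ‖deriv f 0‖ ≤ 2 * Real.exp 1 * m * (1 + Real.posLog (M / m)) / (r * l₀ * K) := by
  -- the sine bound `‖sin w‖ ≤ e^{|Im w|}`
  have hsin : ∀ w : ℂ, ‖Complex.sin w‖ ≤ Real.exp |w.im| := fun w => by
    have h2 : (2 : ℂ) * Complex.sin w = (Complex.exp (-w * I) - Complex.exp (w * I)) * I := Complex.two_sin w
    have hn : ‖(2 : ℂ) * Complex.sin w‖ ≤ Real.exp |w.im| + Real.exp |w.im| := by
      rw [h2, norm_mul, Complex.norm_I, mul_one]
      refine (norm_sub_le _ _).trans (add_le_add ?_ ?_)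
      · rw [Complex.norm_exp]
        refine Real.exp_le_exp.2 ?_
        simp only [Complex.mul_re, Complex.neg_re, Complex.neg_im, Complex.I_re, Complex.I_im, mul_zero,
          mul_one, zero_sub, neg_neg]
        exact le_abs_self _
      · rw [Complex.norm_exp]
        refine Real.exp_le_exp.2 ?_
        simp only [Complex.mul_re, Complex.I_re, Complex.I_im, mul_zero, mul_one, zero_sub]
        exact neg_le_abs _
    rw [norm_mul, Complex.norm_ofNat] at hn
    linarith
  -- the gauge
  set φ : ℂ → ℂ := fun w => (l₀ : ℂ) * Complex.sin ((K : ℂ) * w) with hφ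
  have hφd : Differentiable ℂ φ :=
    (Complex.differentiable_sin.comp (differentiable_id.const_mul (K : ℂ))).const_mul (l₀ : ℂ)
  have hφ0 : φ 0 = 0 := by simp [hφ]
  have hφM : ∀ w : ℂ, ‖w‖ ≤ r → ‖φ w‖ ≤ l₀ * Real.exp (K * r) := fun w hw => by
    simp only [hφ]
    rw [norm_mul, Complex.norm_real, Real.norm_eq_abs, abs_of_pos hl₀]
    refine mul_le_mul_of_nonneg_left ((hsin _).trans (Real.exp_le_exp.2 ?_)) hl₀.le
    rw [Complex.mul_im, Complex.ofReal_re, Complex.ofReal_im, zero_mul, add_zero, abs_mul, abs_of_pos hK]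
    exact mul_le_mul_of_nonneg_left ((Complex.abs_im_le_norm w).trans hw) hK.le
  have hφx : ∀ x : ℝ, φ x = ((l₀ * Real.sin (K * x) : ℝ) : ℂ) := fun x => by
    simp only [hφ]
    push_cast
    rfl
  -- the composite and its two constants
  have hg : Differentiable ℂ (f ∘ φ) := hf.comp hφd
  have hMg : ∀ w : ℂ, ‖w‖ ≤ r → ‖(f ∘ φ) w‖ ≤ M := fun w hw => hM _ (hφM w hw)
  have hmg : ∀ x : ℝ, |x| < r → ‖(f ∘ φ) x‖ ≤ m := fun x _ => by
    show ‖f (φ x)‖ ≤ m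
    rw [hφx]
    refine hm _ ?_
    rw [abs_mul, abs_of_pos hl₀]
    exact mul_le_of_le_one_right hl₀.le (Real.abs_sin_le_one _)
  have key := norm_deriv_le_linlog hr hg.diffContOnCl hMg hmg hm0
  -- the chain rule at `0`: `(f ∘ φ)′(0) = (l₀K) • f′(0)`
  have h1 : HasDerivAt (fun w : ℂ => (K : ℂ) * w) (K : ℂ) 0 := by
    simpa using (hasDerivAt_id (0 : ℂ)).const_mul (K : ℂ)
  have h2 : HasDerivAt (fun w : ℂ => Complex.sin ((K : ℂ) * w)) (Complex.cos ((K : ℂ) * 0) * (K : ℂ)) 0 :=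
    (Complex.hasDerivAt_sin _).comp 0 h1
  have h3 : HasDerivAt φ ((l₀ : ℂ) * (Complex.cos ((K : ℂ) * 0) * (K : ℂ))) 0 := h2.const_mul (l₀ : ℂ)
  rw [mul_zero, Complex.cos_zero, one_mul] at h3
  have hcomp : HasDerivAt (f ∘ φ) (((l₀ : ℂ) * (K : ℂ)) • deriv f (φ 0)) 0 :=
    (hf (φ 0)).hasDerivAt.scomp 0 h3
  rw [hφ0] at hcomp
  rw [hcomp.deriv, norm_smul, norm_mul, Complex.norm_real, Complex.norm_real, Real.norm_eq_abs, Real.norm_eq_abs,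
    abs_of_pos hl₀, abs_of_pos hK] at key
  rw [le_div_iff₀ (by positivity)]
  calc ‖deriv f 0‖ * (r * l₀ * K) = l₀ * K * ‖deriv f 0‖ * r := by ring
    _ ≤ 2 * Real.exp 1 * m * (1 + Real.posLog (M / m)) / r * r := mul_le_mul_of_nonneg_right key hr.le
    _ = 2 * Real.exp 1 * m * (1 + Real.posLog (M / m)) := div_mul_cancel₀ _ hr.ne'

end Complex

/-! ## §2 Two probability spaces: the price `ε·log ε⁻¹ ∕ log log ε⁻¹` [folklore] -/

section MGF

variable {Ω Ω' : Type*} [MeasurableSpace Ω] [MeasurableSpace Ω'] {μ : Measure Ω} {ν : Measure Ω'}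
  [IsProbabilityMeasure μ] [IsProbabilityMeasure ν] {X : Ω → ℝ} {Y : Ω' → ℝ} {B : ℝ}

/-- **GAUGE FORM (every `K > 0`).**  Two probability spaces, observables `|X|, |Y| ≤ B` a.e.; if `|cgf_Y(t) − cgf_X(t)| ≤ ε` for every real
`|t| ≤ l₀` (`0 < l₀`, `0 ≤ ε`), then for every `K > 0`
`|∫ Y dν − ∫ X dμ| ≤ 4·e^{1+l₀B}·ε·(1 + l₀B·(e^{K} − 1) + log⁺ ε⁻¹)∕(l₀·K)`
— §1 for the entire function `complexMGF Y ν − complexMGF X μ` (bound `2e^{l₀e^{K}B}` on the disc `|z| ≤ l₀e^{K}` by exponential type, bound `2ε·e^{l₀B}` on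
the segment), whose derivative at `0` is the difference of the means. [folklore] -/
theorem abs_integral_sub_integral_le_of_cgf_close_gauge (hX : AEMeasurable X μ) (hY : AEMeasurable Y ν)
    (hXB : ∀ᵐ ω ∂μ, |X ω| ≤ B) (hYB : ∀ᵐ ω ∂ν, |Y ω| ≤ B) {ε l₀ K : ℝ} (hl₀ : 0 < l₀) (hK : 0 < K) (hε0 : 0 ≤ ε)
    (hε : ∀ t : ℝ, |t| ≤ l₀ → |cgf Y ν t - cgf X μ t| ≤ ε) :
    |∫ ω, Y ω ∂ν - ∫ ω, X ω ∂μ| ≤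
      4 * Real.exp (1 + l₀ * B) * ε * (1 + l₀ * B * (Real.exp K - 1) + Real.posLog ε⁻¹) / (l₀ * K) := by
  have hB0 : 0 ≤ B := T4GenFunBounds.nonneg_of_ae_abs_le (IsProbabilityMeasure.ne_zero μ) hXB
  set f : ℂ → ℂ := fun z => complexMGF Y ν z - complexMGF X μ z with hf
  have hdY := T4GenFunBounds.differentiable_complexMGF_of_abs_le hY hYB
  have hdX := T4GenFunBounds.differentiable_complexMGF_of_abs_le hX hXB
  have hfd : Differentiable ℂ f := hdY.sub hdX
  -- big-disc bound (exponential type)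
  have hM : ∀ z : ℂ, ‖z‖ ≤ l₀ * Real.exp (K * 1) → ‖f z‖ ≤ 2 * Real.exp (l₀ * Real.exp K * B) := fun z hz => by
    rw [mul_one] at hz
    refine (norm_complexMGF_sub_complexMGF_le hXB hYB z).trans ?_
    gcongr
  -- short-segment bound
  have hm : ∀ x : ℝ, |x| ≤ l₀ → ‖f x‖ ≤ 2 * ε * Real.exp (l₀ * B) := fun x hx => by
    show ‖complexMGF Y ν x - complexMGF X μ x‖ ≤ _
    rw [complexMGF_ofReal, complexMGF_ofReal, ← Complex.ofReal_sub, Complex.norm_real, Real.norm_eq_abs]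
    exact (abs_mgf_sub_mgf_le_of_cgf_close hX hY hXB hYB (hε x hx)).trans (by gcongr)
  have key := norm_deriv_le_linlog_of_short_segment hl₀ hK one_pos hfd hM hm (by positivity)
  -- the derivative at `0` is the difference of the means
  have hderiv : deriv f 0 = (((∫ ω, Y ω ∂ν) - ∫ ω, X ω ∂μ : ℝ) : ℂ) := by
    have e1 : deriv f 0 = deriv (complexMGF Y ν) 0 - deriv (complexMGF X μ) 0 :=
      deriv_sub (hdY 0) (hdX 0)
    have eY := T4GenFunBounds.iteratedDeriv_complexMGF_zero_of_abs_le hY hYB 1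
    have eX := T4GenFunBounds.iteratedDeriv_complexMGF_zero_of_abs_le hX hXB 1
    rw [iteratedDeriv_one] at eY eX
    rw [e1, eY, eX, Complex.ofReal_sub]
    simp
  rw [hderiv, Complex.norm_real, Real.norm_eq_abs, one_mul] at key
  refine key.trans ?_
  rcases hε0.eq_or_lt with hε00 | hεpos
  · rw [← hε00]; simp
  -- `log⁺ (M/m) ≤ l₀B(e^K − 1) + log⁺ ε⁻¹`
  have hq : 2 * Real.exp (l₀ * Real.exp K * B) / (2 * ε * Real.exp (l₀ * B)) =
      Real.exp (l₀ * B * (Real.exp K - 1)) * ε⁻¹ := by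
    rw [show l₀ * B * (Real.exp K - 1) = l₀ * Real.exp K * B - l₀ * B by ring, Real.exp_sub]
    field_simp
  have hc0 : 0 ≤ l₀ * B * (Real.exp K - 1) :=
    mul_nonneg (mul_nonneg hl₀.le hB0) (by linarith [Real.add_one_le_exp K, hK.le])
  have hlog : Real.posLog (2 * Real.exp (l₀ * Real.exp K * B) / (2 * ε * Real.exp (l₀ * B))) ≤
      l₀ * B * (Real.exp K - 1) + Real.posLog ε⁻¹ := by
    rw [hq]
    refine Real.posLog_mul.trans (add_le_add (le_of_eq ?_) le_rfl)
    rw [Real.posLog_eq_log (by rw [abs_of_pos (Real.exp_pos _)]; exact Real.one_le_exp hc0), Real.log_exp]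
  calc 2 * Real.exp 1 * (2 * ε * Real.exp (l₀ * B)) *
        (1 + Real.posLog (2 * Real.exp (l₀ * Real.exp K * B) / (2 * ε * Real.exp (l₀ * B)))) / (l₀ * K)
      ≤ 2 * Real.exp 1 * (2 * ε * Real.exp (l₀ * B)) * (1 + (l₀ * B * (Real.exp K - 1) + Real.posLog ε⁻¹)) / (l₀ * K) := by
        gcongr
    _ = 4 * Real.exp (1 + l₀ * B) * ε * (1 + l₀ * B * (Real.exp K - 1) + Real.posLog ε⁻¹) / (l₀ * K) := by
        rw [Real.exp_add]; ring

/-- **THE SHARP PRICE: CLOSE CGF's ON A REAL SEGMENT PAY THE MEANS `ε·log ε⁻¹ ∕ log log ε⁻¹`.**  Two probability spaces, observables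
`|X|, |Y| ≤ B` a.e.; if `|cgf_Y(t) − cgf_X(t)| ≤ ε` for every real `|t| ≤ l₀` (`0 < l₀`, `0 ≤ ε`), then
`|∫ Y dν − ∫ X dμ| ≤ 4·e^{1+e·l₀B}·ε·(1 + log⁺ ε⁻¹)∕(l₀·log(e + log⁺ ε⁻¹))`
(the gauge form at `e^{K} = e + log⁺ ε⁻¹`, then `1 + l₀B(e − 1 + L) + L ≤ (1 + (e−1)l₀B)(1 + L) ≤ e^{(e−1)l₀B}(1 + L)`).  Improves p480837's
`4e^{1+l₀B}·ε·(1 + log⁺ ε⁻¹)∕l₀` by the factor `log(e + log⁺ ε⁻¹)∕e^{(e−1)l₀B}` — a gain exactly when `log(e + log⁺ ε⁻¹) > e^{(e−1)l₀B}`, i.e. for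
small `ε` (both bounds hold; take the minimum); the order in `ε` is attained (sibling §3). [folklore] -/
theorem abs_integral_sub_integral_le_sharp_of_cgf_close (hX : AEMeasurable X μ) (hY : AEMeasurable Y ν)
    (hXB : ∀ᵐ ω ∂μ, |X ω| ≤ B) (hYB : ∀ᵐ ω ∂ν, |Y ω| ≤ B) {ε l₀ : ℝ} (hl₀ : 0 < l₀) (hε0 : 0 ≤ ε)
    (hε : ∀ t : ℝ, |t| ≤ l₀ → |cgf Y ν t - cgf X μ t| ≤ ε) :
    |∫ ω, Y ω ∂ν - ∫ ω, X ω ∂μ| ≤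
      4 * Real.exp (1 + Real.exp 1 * l₀ * B) * ε * (1 + Real.posLog ε⁻¹) /
        (l₀ * Real.log (Real.exp 1 + Real.posLog ε⁻¹)) := by
  have hB0 : 0 ≤ B := T4GenFunBounds.nonneg_of_ae_abs_le (IsProbabilityMeasure.ne_zero μ) hXB
  set L := Real.posLog ε⁻¹ with hL
  have hL0 : 0 ≤ L := Real.posLog_nonneg
  have heL : 0 < Real.exp 1 + L := by positivity
  set K := Real.log (Real.exp 1 + L) with hK
  have hK1 : 1 ≤ K := by
    rw [hK, Real.le_log_iff_exp_le heL]
    linarith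
  have hK0 : 0 < K := one_pos.trans_le hK1
  have hexpK : Real.exp K = Real.exp 1 + L := Real.exp_log heL
  have h := abs_integral_sub_integral_le_of_cgf_close_gauge hX hY hXB hYB hl₀ hK0 hε0 hε
  rw [hexpK] at h
  refine h.trans ?_
  have hb : 0 ≤ l₀ * B := mul_nonneg hl₀.le hB0
  have he2 : 2 ≤ Real.exp 1 := by linarith [Real.add_one_le_exp (1 : ℝ)]
  -- numerator
  have hnum : 1 + l₀ * B * (Real.exp 1 + L - 1) + L ≤ Real.exp ((Real.exp 1 - 1) * (l₀ * B)) * (1 + L) := by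
    have h1 : 1 + l₀ * B * (Real.exp 1 + L - 1) + L ≤ (1 + (Real.exp 1 - 1) * (l₀ * B)) * (1 + L) := by
      nlinarith [mul_nonneg hb hL0]
    refine h1.trans (mul_le_mul_of_nonneg_right ?_ (by positivity))
    linarith [Real.add_one_le_exp ((Real.exp 1 - 1) * (l₀ * B))]
  calc 4 * Real.exp (1 + l₀ * B) * ε * (1 + l₀ * B * (Real.exp 1 + L - 1) + L) / (l₀ * K)
      ≤ 4 * Real.exp (1 + l₀ * B) * ε * (Real.exp ((Real.exp 1 - 1) * (l₀ * B)) * (1 + L)) / (l₀ * K) := by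
        gcongr
    _ = 4 * Real.exp (1 + Real.exp 1 * l₀ * B) * ε * (1 + L) / (l₀ * K) := by
        rw [show 1 + Real.exp 1 * l₀ * B = (1 + l₀ * B) + (Real.exp 1 - 1) * (l₀ * B) by ring,
          Real.exp_add (1 + l₀ * B)]
        ring

end MGF

/-! ## §4 At the scheme: N19's DECL target in the observable currency, sharp price [bookkeeping] -/

section Scheme

open T4CauchySum (MatchingModConstants genFun)
open T4GenFunBounds (schemeZ prodObs)
open Missing (TorusScheme)
open Summit.QuantumFields.YangMills.BalabanUVNodes.N19ExpectationCurrencyAtScheme (mul_nonneg_of_matchingModConstants)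

variable {G : Type*} [GaugeGroup G] [MeasurableSpace G] [RegularGaugeGroup G] [HaarData G] {O : Type*}
  (S : TorusScheme G O) (hβ : ∀ K, 0 ≤ S.β K) (hm : ∀ K o, Measurable (S.obs K o))
  (h1 : ∀ K o U, |S.obs K o U| ≤ 1)
include hβ hm h1

/-- **N19's TARGET PAYS THE OBSERVABLE INCREMENTS AT THE SHARP PRICE.**  If the dressed partition functions of a string `os` match modulo
constants with remainder `δ` at radius `l₀ > 0` (`T4CauchySum.MatchingModConstants vol l₀ δ (schemeZ S os)` — N19's DECL target without its
summability conjunct), then for every `K`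
`|S.expectAt (K+1) os − S.expectAt K os| ≤ (8·e^{1+e·l₀}∕l₀)·(vol·δ_K)·(1 + log⁺ (2volδ_K)⁻¹)∕log(e + log⁺ (2volδ_K)⁻¹)`
— §2's sharp theorem for the product observables (bounded by `1`) under the two Gibbs measures, whose cgf's are `genFun (schemeZ S os) K`
(`T4GenFunBounds.genFun_schemeZ_eq_cgf`) and are `2volδ_K`-close on `|t| ≤ l₀` (`T4CauchySum.abs_genFun_succ_sub_le`); p481156's
`abs_expectAt_succ_sub_le_linlog_of_matchingModConstants` divided by the `log log`. [folklore] -/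
theorem abs_expectAt_succ_sub_le_sharp_of_matchingModConstants {vol l₀ : ℝ} {δ : ℕ → ℝ} (hl₀ : 0 < l₀) (os : List O)
    (hM : MatchingModConstants vol l₀ δ (schemeZ S os)) (K : ℕ) :
    |S.expectAt (K + 1) os - S.expectAt K os| ≤
      8 * Real.exp (1 + Real.exp 1 * l₀) / l₀ * (vol * δ K) * (1 + Real.posLog (2 * (vol * δ K))⁻¹) /
        Real.log (Real.exp 1 + Real.posLog (2 * (vol * δ K))⁻¹) := by
  haveI hP : ∀ K, IsProbabilityMeasure (T4GenFunBounds.gibbsMeasure (G := G) (S.P K) (S.β K)) := fun K =>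
    T4GenFunBounds.isProbabilityMeasure_gibbsMeasure (G := G) (S.P K) (hβ K)
  have hvd : 0 ≤ vol * δ K := mul_nonneg_of_matchingModConstants hl₀.le hM K
  have hmeas : ∀ K, AEMeasurable (prodObs S K os) (T4GenFunBounds.gibbsMeasure (S.P K) (S.β K)) := fun K =>
    (T4GenFunBounds.measurable_prodObs S hm K os).aemeasurable
  have hbd : ∀ K, ∀ᵐ U ∂(T4GenFunBounds.gibbsMeasure (G := G) (S.P K) (S.β K)), |prodObs S K os U| ≤ 1 := fun K =>
    Eventually.of_forall (T4GenFunBounds.abs_prodObs_le_one S h1 K os)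
  have hε : ∀ t : ℝ, |t| ≤ l₀ →
      |cgf (prodObs S (K + 1) os) (T4GenFunBounds.gibbsMeasure (S.P (K + 1)) (S.β (K + 1))) t -
        cgf (prodObs S K os) (T4GenFunBounds.gibbsMeasure (S.P K) (S.β K)) t| ≤ 2 * (vol * δ K) := fun t ht => by
    rw [← T4GenFunBounds.genFun_schemeZ_eq_cgf S hβ hm h1, ← T4GenFunBounds.genFun_schemeZ_eq_cgf S hβ hm h1]
    exact T4CauchySum.abs_genFun_succ_sub_le hM hl₀.le K ht
  have key := abs_integral_sub_integral_le_sharp_of_cgf_close (hmeas K) (hmeas (K + 1)) (hbd K) (hbd (K + 1)) hl₀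
    (by positivity) hε
  rw [← T4GenFunBounds.expectAt_eq_integral_gibbs S hβ, ← T4GenFunBounds.expectAt_eq_integral_gibbs S hβ, mul_one] at key
  refine key.trans (le_of_eq ?_)
  ring

end Scheme

end Summit.QuantumFields.YangMills.Theorems.BalabanUVNodesN19SharpPrice

end
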